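import Summits.BirchSwinnertonDyer.BirchSwinnertonDyer.Theorems.AdditiveKolyvaginRoadLevelKolyvaginSystemsAdditiveGammaLocus
import Summits.BirchSwinnertonDyer.BirchSwinnertonDyer.Theorems.AdditiveKolyvaginRoadLevelKolyvaginSystemsAdditiveStubTamagawaOffP
import Summits.BirchSwinnertonDyer.BirchSwinnertonDyer.Theorems.AdditiveKolyvaginRoadLevelSystemsOfIgnition
import Summits.BirchSwinnertonDyer.BirchSwinnertonDyer.Theorems.AdditiveKolyvaginRoadLevelKolyvaginSystemsAdditiveStubLenderSeed
import Summits.BirchSwinnertonDyer.BirchSwinnertonDyer.Theorems.AdditiveKolyvaginRoadLevelKolyvaginSystemsAdditiveStubKummerLineAtP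
import Summits.BirchSwinnertonDyer.BirchSwinnertonDyer.Theorems.AdditiveKolyvaginRoadSignAgreementOfTorsionCongr
import Summits.BirchSwinnertonDyer.BirchSwinnertonDyer.Theorems.AdditiveKolyvaginRoadLevelKolyvaginSystemsAdditiveStubLenderCoreConnected
import Summits.BirchSwinnertonDyer.BirchSwinnertonDyer.Theorems.AdditiveKolyvaginRoadLevelKolyvaginSystemsAdditiveStubLenderDatumOfZhangFact
import Summits.BirchSwinnertonDyer.BirchSwinnertonDyer.Theorems.AdditiveKolyvaginRoadLevelSystemsSelmerBottom
import Literature.NumberTheory.EllipticCurves.KrizLi2019.HeegnerLogCongruence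
import Literature.NumberTheory.EllipticCurves.WZhang2014.LevelRaisedBipartiteSystem
import Literature.NumberTheory.QuadraticFields.KroneckerSplitting
import Literature.NumberTheory.EllipticCurves.PAdicLFunction
import Literature.NumberTheory.EllipticCurves.RootNumber
import Literature.NumberTheory.EllipticCurves.BSDSelmer
import Literature.NumberTheory.EllipticCurves.BSDSha
import HarnessLib

/-!
# Route `AdditiveKolyvaginRoad`, crux KS′ `LevelKolyvaginSystemsAdditive` (item stmt-BirchSwinnertonDyer-21396):
# KS′ ON THE GOOD-AVATAR-WITH-DATUM LOCUS — the on-locus branch of line `epsilon_matched_retyping` (skeleton v9) with the lender's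
# ORDINARINESS REMOVED and W. Zhang's level-raised bipartite datum DISPLAYED as a per-frame clause of the locus
# (cell `pub/bsd-wall`, lead `cruxlead-stmt-BirchSwinnertonDyer-21396-g0`; `--supports stmt-BirchSwinnertonDyer-21396`, helper)

WHY. In the landed (γ)-avatar theorem `levelKolyvaginSystemsAdditive_onGammaAvatarLocus` (p616119, skeleton v8) the avatar `E₀` is asked to be
good ORDINARY at `p`, and `IsOrdinaryAt W₀ p` is consumed in exactly one place: the instantiation of the named fact
`WZhang2014.exists_levelRaisedBipartiteSystem` (whose source carries "good ordinary" as a standing hypothesis, Notations (v) p. 200) inside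
`stub_lenderDatumOfZhangFact`; every other use is `hgood : W₀.HasGoodReductionAtPrime p` ((θK)ₚ p610049, the Kriz–Li bottom transfer, the
lender's bottom rank).  On the Kodaira (5, II*) SINGLE-SLOPE sub-cell (`ρ̄_{E,5}|I₅ ≅ ω₂ ⊕ ω₂⁵`; census `II-STAR-SHADOW-CENSUS-v1`: 1 113 ♯ rank-1
isogeny classes with `N < 5·10⁵`, every rational shadow found (1 192) SUPERSINGULAR at 5, none ordinary) an ε-matched `p`-good avatar is
necessarily supersingular, so that sub-cell sits in v8's residual only through the word "ordinary".  This file factors the dependence out: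
the locus now asks for a `p`-GOOD avatar together with, for each complex conjugation `c ≠ 1`, a level-raised bipartite DATUM
`d : WZhang2014.LevelRaisedBipartiteData W₀ K p` with the nine printed properties (the ∃-BODY of Zhang's fact, verbatim), and the proof runs
through the fact-agnostic dictionary `LenderDatum.lenderDatum_of_levelRaisedBipartiteData` (p615394).  On good ORDINARY avatars the datum is
supplied by Zhang's fact (`goodAvatarDatumLocus_of_gammaAvatarLocus` below, so v8's locus ⊆ v9's locus granted that fact and p616119 is the
special case); on good SUPERSINGULAR avatars the datum is OWED — W. Zhang 2014 §§3–4/§8.1 at a good non-ordinary prime is not a printed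
statement (p614834 bounced 2026-08-28: stronger than print; Sweeting arXiv:2012.11771 Rem. 1.2 says ordinariness is used only for the anchor but
prints only a one-sided vertical congruence, Cor. 5.7; Da Ronche arXiv:2503.09955 is non-ordinary but needs `|(𝔽_p^×)^{k−1}| > 5`, i.e. `p ≥ 7`
in weight 2, and `N⁺` square-free) — and it is displayed here as a frame-level INPUT instead of being hidden in a hypothesis name.

WHAT. `levelKolyvaginSystemsAdditive_onGoodAvatarDatumLocus`: for every ♯ additive frame `(E, p, K, Dt, β, ι)` of the crux (binders
VERBATIM) carrying a `p`-GOOD non-anomalous ε-matched rational avatar `E₀` (`E₀[p] ≅ E[p]` over `ℚ`, ♠(1), `p ∤ ∏ c_ℓ(E₀)`, `rad(pN) = rad(pN₀)`,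
`N₀ p² = N`, same multiplicative primes, same global root number, Heegner data `(Dt₀, β₀)` with `p ∤ c₀`), a level-raised bipartite datum for
`(E₀, p, K, Dt₀, β₀, ι, c)` for every `c ≠ 1`, and the LOG CERTIFICATE, the carrier `LevelKolyvaginSystemP E K p Dt β ι c` is inhabited for
every `c ≠ 1`, GRANTED ONLY six displayed refereed named facts: Dokchitser–Dokchitser `p`-parity, Cassels–Tate over `ℚ`, Poitou–Tate for
Selmer structures over `ℚ`, Kriz–Li 2019 Thm. 1.16, and the route's bundles `PublishedInputsAdditiveKoly` ∕ `PublishedDualityInputsAdditiveKoly`.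
`goodAvatarDatumLocus_of_gammaAvatarLocus`: Zhang's fact maps v8's (γ)-avatar locus into this locus.  Proof = the proof of p616119 with
`stub_lenderDatumOfZhangFact` replaced by the fact-agnostic dictionary; every other input is the same tree theorem (θ p602788, (Tam) p606147,
(θK)ₚ p610049, sign agreement p609488, lender seed p608045, core-connectivity p611000, rigidity constructor p589600, Kriz–Li bottom transfer and
γ-assembly p604313/p605382/p605510/p605896).

HONEST FRAMING: two theorems, 0 definitions, 0 new named facts, 0 sorry; CONDITIONAL on the six named facts (hypotheses; the gate records
conditional-result) and, per frame, on the displayed datum clause.  It does NOT close KS′ (the crux quantifies over ALL ♯ frames; off the locus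
nothing is claimed), it does not construct a bipartite datum for any supersingular avatar, and BSD is NOT proved by any of this.
-/

set_option linter.dupNamespace false
set_option autoImplicit false

noncomputable section

open scoped Classical

open WeierstrassCurve NumberField IsDedekindDomain Field
  Literature.NumberTheory.EllipticCurves Literature.NumberTheory.EllipticCurves.ModularForms
  Literature.NumberTheory.EllipticCurves.Rank1Residual Literature.NumberTheory.GaloisRepresentations
  Literature.NumberTheory.GaloisCohomology
  Summit.BirchSwinnertonDyer.BirchSwinnertonDyer.Theses.AdditiveKolyvaginRoad
  Summit.BirchSwinnertonDyer.Rank1Residual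

namespace Summit.BirchSwinnertonDyer.BirchSwinnertonDyer.Theorems.AdditiveKoly

/-- **KS′ ON THE GOOD-AVATAR-WITH-DATUM LOCUS, modulo six refereed named facts** (see the module docstring).  The locus is the
inlined ∃-clause: a `p`-GOOD (ordinary or not) non-anomalous ε-matched rational avatar `E₀` with Heegner data, for each `c ≠ 1` a
level-raised bipartite datum with W. Zhang's nine printed properties (the ∃-body of `WZhang2014.exists_levelRaisedBipartiteSystem`,
verbatim), and the log certificate; the conclusion is the crux's own `Nonempty (LevelKolyvaginSystemP W K p Dt β ι c)`.
[cite: WZhang2014, Thm. 2.1, §3.9 (3.30), Thm. 4.3, Thm. 5.2, §8.1] [cite: KrizLi2019, Thm. 1.16] [cite: DokchitserDokchitserAnnals2010, Thm. 1.4]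
[cite: Howard2006Bipartite, Prop. 2.4.11] [cite: BertoliniDarmon2005, Thm. 4.1, Thm. 4.2] [cite: GrossLMS1991, §4 (4.4), Prop. 5.4] -/
theorem levelKolyvaginSystemsAdditive_onGoodAvatarDatumLocus
    (hDD : ∀ (V : WeierstrassCurve ℚ) [V.IsElliptic] (q : ℕ) [Fact q.Prime], p_parity V q)
    (hCT : WeierstrassCurve.exists_casselsTate_pairing (K := ℚ)) (hPT : poitouTate_selmerStructure_duality ℚ)
    (hKL : KrizLi2019.thm116_padicLogHeegner_congruence) (hPUB : PublishedInputsAdditiveKoly) (hDual : PublishedDualityInputsAdditiveKoly)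
    (W : WeierstrassCurve ℚ) [W.IsElliptic] [W.IsGloballyMinimal] [NeZero (W.conductorNorm ℤ)]
    (p : ℕ) [Fact p.Prime] (K : Type) [Field K] [NumberField K]
    (Dt : ModularParametrizationData W (W.conductorNorm ℤ)) (β : ℤ) (ι : K →+* ℂ)
    (hp : 5 ≤ p) (hadd : Addv W p) (hs : W.HasSurjectiveModNGaloisRep p)
    (hsp : ∀ (ℓ : ℕ) [Fact ℓ.Prime], W.HasMultiplicativeReductionAtPrime ℓ → ¬ p ∣ padicValInt ℓ W.minimalDiscriminantInt)
    (htwo : ∃ (ℓ₁ ℓ₂ : ℕ) (_ : Fact ℓ₁.Prime) (_ : Fact ℓ₂.Prime), ℓ₁ ≠ ℓ₂ ∧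
      W.HasMultiplicativeReductionAtPrime ℓ₁ ∧ W.HasMultiplicativeReductionAtPrime ℓ₂)
    (htam : ¬ p ∣ W.tamagawaProduct) (hr : W.analyticRank = 1) (hK : IsImaginaryQuadratic K) (hodd : Odd (NumberField.discr K))
    (hlt : NumberField.discr K < -4) (hH : SatisfiesHeegnerHypothesis (W.conductorNorm ℤ) K)
    (hL : (W.quadraticTwist (NumberField.discr K : ℚ)).entireLFunction 1 ≠ 0)
    (hβ : (4 * (W.conductorNorm ℤ : ℤ)) ∣ β ^ 2 - NumberField.discr K) (hc : ¬ (p : ℤ) ∣ Dt.c)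
    (hav : ∃ (W₀ : WeierstrassCurve ℚ) (_ : W₀.IsElliptic) (_ : W₀.IsGloballyMinimal) (_ : NeZero (W₀.conductorNorm ℤ))
      (Dt₀ : ModularParametrizationData W₀ (W₀.conductorNorm ℤ)) (β₀ : ℤ)
      (e : geomTorsion W (p : ℤ) ≃+ geomTorsion W₀ (p : ℤ)),
      (∀ (σ : absoluteGaloisGroup ℚ) (P : geomTorsion W (p : ℤ)), e (σ • P) = σ • e P) ∧
      W₀.HasGoodReductionAtPrime p ∧ ¬ (p : ℤ) ∣ W₀.frobeniusTrace p - 1 ∧ W₀.HasSurjectiveModNGaloisRep p ∧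
      (∀ (ℓ : ℕ) [Fact ℓ.Prime], W₀.HasMultiplicativeReductionAtPrime ℓ →
        ¬ p ∣ padicValInt ℓ W₀.minimalDiscriminantInt) ∧
      ¬ p ∣ W₀.tamagawaProduct ∧
      (∀ q : ℕ, q.Prime → (q ∣ p * W.conductorNorm ℤ ↔ q ∣ p * W₀.conductorNorm ℤ)) ∧
      W₀.conductorNorm ℤ * p ^ 2 = W.conductorNorm ℤ ∧
      (∀ (ℓ : ℕ) [Fact ℓ.Prime], W.HasMultiplicativeReductionAtPrime ℓ ↔ W₀.HasMultiplicativeReductionAtPrime ℓ) ∧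
      W₀.rootNumber = W.rootNumber ∧ SatisfiesHeegnerHypothesis (W₀.conductorNorm ℤ) K ∧
      (4 * (W₀.conductorNorm ℤ : ℤ)) ∣ β₀ ^ 2 - NumberField.discr K ∧ ¬ (p : ℤ) ∣ Dt₀.c ∧
      (∀ c : K ≃ₐ[ℚ] K, c ≠ 1 → ∃ d : WZhang2014.LevelRaisedBipartiteData W₀ K p,
        (∀ m, d.sign m = 1 ∨ d.sign m = -1) ∧ d.IsRealisation Dt₀ β₀ ι ∧ d.IsSignEigen c ∧ d.SatisfiesKummerOff ∧
          d.SatisfiesKummerInf ∧ d.SatisfiesToricOn ∧ d.SatisfiesTransverseOn ι ∧ d.SatisfiesRelation ∧ d.SatisfiesFirstLaw ∧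
          d.SatisfiesSecondLaw) ∧
      ∃ (ιp : K →+* ℚ_[p]) (H₀ : HeegnerDatum (W₀.conductorNorm ℤ) (NumberField.discr K))
        (y₀ : (W₀.baseChange K).toAffine.Point),
        H₀.β = β₀ ∧ WeierstrassCurve.Affine.Point.map ι.toRatAlgHom y₀ = heegnerPointComplex Dt₀ H₀ ∧
          ¬ ∃ Q : (W₀.baseChange ℚ_[p]).toAffine.Point, (p : ℤ) • Q = X11b.padicPointOf W₀ p ιp y₀) :
    ∀ (c : K ≃ₐ[ℚ] K), c ≠ 1 → ∀ [Module (ZMod p) (Vp W K p)], Nonempty (LevelKolyvaginSystemP W K p Dt β ι c) := by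
  intro c hc1 _
  obtain ⟨W₀, _, _, _, Dt₀, β₀, e, he, hgood, hna, hs₀, hsp₀, htam₀, hrad, hN₀, htype, hroot, hH₀, hβ₀, hc₀, hdat,
    ιp, hcert⟩ := hav
  -- locus clause (i) SIGN AGREEMENT is automatic (w3 g5, p609488: Tate curve + torsion congruence at a multiplicative ℓ ≠ p)
  have hsign : ∀ (ℓ : ℕ) [Fact ℓ.Prime], W₀.HasMultiplicativeReductionAtPrime ℓ → W.LFunction ℓ = W₀.LFunction ℓ :=
    sign_agreement_of_torsionCongr W W₀ p hp hadd hsp₀ htype e he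
  -- `p` splits in `K`: `p ∣ N_E` (additive reduction) and `K` is Heegner for `N_E`
  have hsplit : ((Ideal.span {(p : ℤ)}).primesOver (𝓞 K)).ncard = 2 :=
    hH p (Fact.out : p.Prime) ((W.dvd_conductorNorm_iff_not_hasGoodReductionAtPrime p).mpr hadd.1)
  -- Hypothesis ♠(2) for the avatar: the frame's two multiplicative primes are multiplicative for `E₀`
  have htwo₀ : ∃ (ℓ₁ ℓ₂ : ℕ) (_ : Fact ℓ₁.Prime) (_ : Fact ℓ₂.Prime), ℓ₁ ≠ ℓ₂ ∧
      W₀.HasMultiplicativeReductionAtPrime ℓ₁ ∧ W₀.HasMultiplicativeReductionAtPrime ℓ₂ := by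
    obtain ⟨ℓ₁, ℓ₂, i₁, i₂, hne, h₁, h₂⟩ := htwo
    exact ⟨ℓ₁, ℓ₂, i₁, i₂, hne, (htype ℓ₁).mp h₁, (htype ℓ₂).mp h₂⟩
  -- the `ZMod p`-structure on `H¹(K, E₀[p])` (killed by `p ^ 1`)
  letI : Module (ZMod p) (Vp W₀ K p) := AddCommGroup.zmodModule (fun x ↦ by
    simpa only [pow_one] using nsmul_galH1Torsion_natCast_eq_zero (W₀.baseChange K) (p ^ 1) x)
  -- (Tam) at the bad places prime to `p` (landed stub S3, w3 p606147), (θK)ₚ above `p` (landed stub S4, w2 p610049)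
  have hTam : ∀ v : HeightOneSpectrum (𝓞 K), (p : 𝓞 K) ∉ v.asIdeal →
      ¬ ((W.baseChange K).HasGoodReductionAt v ∧ (W₀.baseChange K).HasGoodReductionAt v) →
      ¬ p ∣ ((W.baseChange K).baseChange (v.adicCompletion K)).localTamagawaNumber (v.adicCompletionIntegers K) ∧
      ¬ p ∣ ((W₀.baseChange K).baseChange (v.adicCompletion K)).localTamagawaNumber (v.adicCompletionIntegers K) :=
    fun v hvp hv ↦ stub_tamagawaOffP W W₀ p K htam htam₀ hK hH hrad v hvp hv
  have hKumP : ∀ (θ : geomTorsion (W₀.baseChange K) ((p ^ 1 : ℕ) : ℤ) ≃+ geomTorsion (W.baseChange K) ((p ^ 1 : ℕ) : ℤ))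
      (hθ : ∀ (g : absoluteGaloisGroup K) (P : geomTorsion (W₀.baseChange K) ((p ^ 1 : ℕ) : ℤ)), θ (g • P) = g • θ P),
      ∀ v : HeightOneSpectrum (𝓞 K), (p : 𝓞 K) ∈ v.asIdeal →
      ∀ y : Vp W₀ K p, h1Equiv θ hθ y ∈ selmerLocalKer (W.baseChange K) (v.adicCompletion K) ((p ^ 1 : ℕ) : ℤ) ↔
        y ∈ selmerLocalKer (W₀.baseChange K) (v.adicCompletion K) ((p ^ 1 : ℕ) : ℤ) :=
    fun θ hθ v hvp y ↦ stub_kummerLineAtP W W₀ p K (hDD W p) (hDD W₀ p) hCT hPT hp hs htam htam₀ hrad hgood hna hroot hK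
      hsplit e he θ hθ v hvp y
  -- the certificate, in the weaker `β`-free form consumed by the (γ)-transfer
  have hcert' : ∃ (H₀ : HeegnerDatum (W₀.conductorNorm ℤ) (NumberField.discr K)) (y₀ : (W₀.baseChange K).toAffine.Point),
      WeierstrassCurve.Affine.Point.map ι.toRatAlgHom y₀ = heegnerPointComplex Dt₀ H₀ ∧
        ¬ ∃ Q : (W₀.baseChange ℚ_[p]).toAffine.Point, (p : ℤ) • Q = X11b.padicPointOf W₀ p ιp y₀ := by
    obtain ⟨H₀, y₀, -, h₁, h₂⟩ := hcert
    exact ⟨H₀, y₀, h₁, h₂⟩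
  -- THE LENDER's LEVEL SYSTEM from its bipartite datum (S5a), its seed (S5c) and core-connectivity (S5b), by rigidity
  have hseed₀ : ∀ d₀ : KolyvaginHeegnerData Dt₀ β₀ ι 1, d₀.kolyvaginClass (Fact.out : p.Prime) 1 ≠ 0 :=
    stub_lenderSeed W₀ p K Dt₀ β₀ ι hp hs₀ hK hlt hH₀ ιp hcert
  -- THE LENDER's BIPARTITE DATUM: displayed in the locus (for this `c`), read through the fact-agnostic dictionary (w2 g4, p615394)
  obtain ⟨d, hsg, hreal', hS', hoff', hinf', htor', htr', hrel', hA', hB'⟩ := hdat c hc1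
  obtain ⟨ε₀, κ₀, lam, hreal, hsgn, hoff, hinf, htor, htr, hrel, hA, hB⟩ :=
    LenderDatum.lenderDatum_of_levelRaisedBipartiteData W₀ p K Dt₀ β₀ ι c d hsg hreal' hS' hoff' hinf' htor' htr' hrel' hA' hB'
  have hconn := stub_lenderCoreConnected W W₀ p K Dt Dt₀ β β₀ ι c hPUB hDual hKL hp hadd hs hsp htwo htam hr hK hodd hlt hH
    hL hβ hc e he hgood hna hs₀ hsp₀ htam₀ hrad hN₀ htype hroot hH₀ hβ₀ hc₀ hsign hc1 hKumP hseed₀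
  have hseed : (Even (∅ : Finset (AdmQ W₀ K p)).card ∧ κ₀ ∅ ∅ ≠ 0) ∨
      (Odd (∅ : Finset (AdmQ W₀ K p)).card ∧ lam ∅ ∅ ≠ 0) := by
    refine Or.inl ⟨by simp, ?_⟩
    obtain ⟨d₁, hd₁⟩ := hreal ∅
    rw [hd₁]
    exact hseed₀ d₁
  obtain ⟨S₀⟩ := nonempty_levelKolyvaginSystemP_of_bipartite_of_seed W₀ K p c Dt₀ β₀ ι ε₀ κ₀ lam hreal hsgn hoff hinf htor
    htr hrel hA hB (selmer_bottom_of_realisation W₀ p K Dt₀ β₀ ι hs₀ hK hH₀ hc1 κ₀ hreal) ∅ hseed hconn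
  -- the landed (γ)-locus assembly (θ = landed S2, Kraus–Oesterlé, Kriz–Li bottom transfer, socket v3)
  exact nonempty_levelKolyvaginSystemP_on_gammaLocus W W₀ K p c hKL Dt β ι hp hadd hs hK hlt hH hβ hc e he hgood hna hrad
    htype hsign Dt₀ β₀ hc₀ hH₀ ιp S₀ hTam hKumP hcert'

/-- **v8's (γ)-avatar locus lies inside the good-avatar-with-datum locus, granted W. Zhang's fact.**  On a ♯ additive frame (only
`Addv`, ♠(2), `K` imaginary quadratic with `d_K < −4` and the Heegner hypothesis for `N_E` are used: `p ∣ N_E` splits in `K`, so `p ∤ d_K`),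
a `p`-good ORDINARY avatar as in `levelKolyvaginSystemsAdditive_onGammaAvatarLocus` (p616119) carries, for every `c ≠ 1`, the level-raised
bipartite datum by the named fact `WZhang2014.exists_levelRaisedBipartiteSystem` instantiated at `(E₀, p, K, Dt₀, β₀, ι, c)` (Hypothesis ♠(2)
for `E₀` from the frame's two multiplicative primes through `htype`).  Hence p616119 = `levelKolyvaginSystemsAdditive_onGoodAvatarDatumLocus`
∘ this lemma, and skeleton v9's residual (off the datum locus) is contained in v8's residual (off the (γ)-avatar locus) granted the fact.
[cite: WZhang2014, Notations (v), Thm. 2.1, §3.9 (3.30), Thm. 4.3, Thm. 5.2, §8.1] -/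
theorem goodAvatarDatumLocus_of_gammaAvatarLocus (hZ : WZhang2014.exists_levelRaisedBipartiteSystem)
    (W : WeierstrassCurve ℚ) [W.IsElliptic] [W.IsGloballyMinimal] [NeZero (W.conductorNorm ℤ)]
    (p : ℕ) [Fact p.Prime] (K : Type) [Field K] [NumberField K] (ι : K →+* ℂ)
    (hp : 5 ≤ p) (hadd : Addv W p)
    (htwo : ∃ (ℓ₁ ℓ₂ : ℕ) (_ : Fact ℓ₁.Prime) (_ : Fact ℓ₂.Prime), ℓ₁ ≠ ℓ₂ ∧
      W.HasMultiplicativeReductionAtPrime ℓ₁ ∧ W.HasMultiplicativeReductionAtPrime ℓ₂)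
    (hK : IsImaginaryQuadratic K) (hlt : NumberField.discr K < -4) (hH : SatisfiesHeegnerHypothesis (W.conductorNorm ℤ) K)
    (hav : ∃ (W₀ : WeierstrassCurve ℚ) (_ : W₀.IsElliptic) (_ : W₀.IsGloballyMinimal) (_ : NeZero (W₀.conductorNorm ℤ))
      (Dt₀ : ModularParametrizationData W₀ (W₀.conductorNorm ℤ)) (β₀ : ℤ)
      (e : geomTorsion W (p : ℤ) ≃+ geomTorsion W₀ (p : ℤ)),
      (∀ (σ : absoluteGaloisGroup ℚ) (P : geomTorsion W (p : ℤ)), e (σ • P) = σ • e P) ∧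
      IsOrdinaryAt W₀ p ∧ ¬ (p : ℤ) ∣ W₀.frobeniusTrace p - 1 ∧ W₀.HasSurjectiveModNGaloisRep p ∧
      (∀ (ℓ : ℕ) [Fact ℓ.Prime], W₀.HasMultiplicativeReductionAtPrime ℓ →
        ¬ p ∣ padicValInt ℓ W₀.minimalDiscriminantInt) ∧
      ¬ p ∣ W₀.tamagawaProduct ∧
      (∀ q : ℕ, q.Prime → (q ∣ p * W.conductorNorm ℤ ↔ q ∣ p * W₀.conductorNorm ℤ)) ∧
      W₀.conductorNorm ℤ * p ^ 2 = W.conductorNorm ℤ ∧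
      (∀ (ℓ : ℕ) [Fact ℓ.Prime], W.HasMultiplicativeReductionAtPrime ℓ ↔ W₀.HasMultiplicativeReductionAtPrime ℓ) ∧
      W₀.rootNumber = W.rootNumber ∧ SatisfiesHeegnerHypothesis (W₀.conductorNorm ℤ) K ∧
      (4 * (W₀.conductorNorm ℤ : ℤ)) ∣ β₀ ^ 2 - NumberField.discr K ∧ ¬ (p : ℤ) ∣ Dt₀.c ∧
      ∃ (ιp : K →+* ℚ_[p]) (H₀ : HeegnerDatum (W₀.conductorNorm ℤ) (NumberField.discr K))
        (y₀ : (W₀.baseChange K).toAffine.Point),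
        H₀.β = β₀ ∧ WeierstrassCurve.Affine.Point.map ι.toRatAlgHom y₀ = heegnerPointComplex Dt₀ H₀ ∧
          ¬ ∃ Q : (W₀.baseChange ℚ_[p]).toAffine.Point, (p : ℤ) • Q = X11b.padicPointOf W₀ p ιp y₀) :
    ∃ (W₀ : WeierstrassCurve ℚ) (_ : W₀.IsElliptic) (_ : W₀.IsGloballyMinimal) (_ : NeZero (W₀.conductorNorm ℤ))
      (Dt₀ : ModularParametrizationData W₀ (W₀.conductorNorm ℤ)) (β₀ : ℤ)
      (e : geomTorsion W (p : ℤ) ≃+ geomTorsion W₀ (p : ℤ)),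
      (∀ (σ : absoluteGaloisGroup ℚ) (P : geomTorsion W (p : ℤ)), e (σ • P) = σ • e P) ∧
      W₀.HasGoodReductionAtPrime p ∧ ¬ (p : ℤ) ∣ W₀.frobeniusTrace p - 1 ∧ W₀.HasSurjectiveModNGaloisRep p ∧
      (∀ (ℓ : ℕ) [Fact ℓ.Prime], W₀.HasMultiplicativeReductionAtPrime ℓ →
        ¬ p ∣ padicValInt ℓ W₀.minimalDiscriminantInt) ∧
      ¬ p ∣ W₀.tamagawaProduct ∧
      (∀ q : ℕ, q.Prime → (q ∣ p * W.conductorNorm ℤ ↔ q ∣ p * W₀.conductorNorm ℤ)) ∧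
      W₀.conductorNorm ℤ * p ^ 2 = W.conductorNorm ℤ ∧
      (∀ (ℓ : ℕ) [Fact ℓ.Prime], W.HasMultiplicativeReductionAtPrime ℓ ↔ W₀.HasMultiplicativeReductionAtPrime ℓ) ∧
      W₀.rootNumber = W.rootNumber ∧ SatisfiesHeegnerHypothesis (W₀.conductorNorm ℤ) K ∧
      (4 * (W₀.conductorNorm ℤ : ℤ)) ∣ β₀ ^ 2 - NumberField.discr K ∧ ¬ (p : ℤ) ∣ Dt₀.c ∧
      (∀ c : K ≃ₐ[ℚ] K, c ≠ 1 → ∃ d : WZhang2014.LevelRaisedBipartiteData W₀ K p,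
        (∀ m, d.sign m = 1 ∨ d.sign m = -1) ∧ d.IsRealisation Dt₀ β₀ ι ∧ d.IsSignEigen c ∧ d.SatisfiesKummerOff ∧
          d.SatisfiesKummerInf ∧ d.SatisfiesToricOn ∧ d.SatisfiesTransverseOn ι ∧ d.SatisfiesRelation ∧ d.SatisfiesFirstLaw ∧
          d.SatisfiesSecondLaw) ∧
      ∃ (ιp : K →+* ℚ_[p]) (H₀ : HeegnerDatum (W₀.conductorNorm ℤ) (NumberField.discr K))
        (y₀ : (W₀.baseChange K).toAffine.Point),
        H₀.β = β₀ ∧ WeierstrassCurve.Affine.Point.map ι.toRatAlgHom y₀ = heegnerPointComplex Dt₀ H₀ ∧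
          ¬ ∃ Q : (W₀.baseChange ℚ_[p]).toAffine.Point, (p : ℤ) • Q = X11b.padicPointOf W₀ p ιp y₀ := by
  obtain ⟨W₀, hE₀, hM₀, hN0, Dt₀, β₀, e, he, hord, hna, hs₀, hsp₀, htam₀, hrad, hN₀, htype, hroot, hH₀, hβ₀, hc₀,
    ιp, hcert⟩ := hav
  -- `p` splits in `K` (`p ∣ N_E`, Heegner hypothesis), hence `p ∤ d_K` (decomposition law, `p` odd)
  have hsplit : ((Ideal.span {(p : ℤ)}).primesOver (𝓞 K)).ncard = 2 :=
    hH p (Fact.out : p.Prime) ((W.dvd_conductorNorm_iff_not_hasGoodReductionAtPrime p).mpr hadd.1)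
  have hpd : ¬ ((p : ℤ) ∣ NumberField.discr K) := by
    have hp2 : p ≠ 2 := by omega
    have hleg := (Literature.NumberTheory.QuadraticFields.Quadratic.ncard_primesOver_eq_two_iff_legendreSym hK.1 hp2).mp hsplit
    intro hdvd
    have h0 : legendreSym p (NumberField.discr K) = 0 :=
      (legendreSym.eq_zero_iff p _).mpr ((ZMod.intCast_zmod_eq_zero_iff_dvd _ p).mpr hdvd)
    rw [h0] at hleg
    exact zero_ne_one hleg
  -- Hypothesis ♠(2) for the avatar
  have htwo₀ : ∃ (ℓ₁ ℓ₂ : ℕ) (_ : Fact ℓ₁.Prime) (_ : Fact ℓ₂.Prime), ℓ₁ ≠ ℓ₂ ∧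
      W₀.HasMultiplicativeReductionAtPrime ℓ₁ ∧ W₀.HasMultiplicativeReductionAtPrime ℓ₂ := by
    obtain ⟨ℓ₁, ℓ₂, i₁, i₂, hne, h₁, h₂⟩ := htwo
    exact ⟨ℓ₁, ℓ₂, i₁, i₂, hne, (htype ℓ₁).mp h₁, (htype ℓ₂).mp h₂⟩
  exact ⟨W₀, hE₀, hM₀, hN0, Dt₀, β₀, e, he, hord.1, hna, hs₀, hsp₀, htam₀, hrad, hN₀, htype, hroot, hH₀, hβ₀, hc₀,
    fun c hc1 ↦ hZ W₀ p K Dt₀ β₀ ι c hp hord hs₀ hsp₀ (Or.inr htwo₀) hK hlt hpd hH₀ hβ₀ hc1, ιp, hcert⟩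

end Summit.BirchSwinnertonDyer.BirchSwinnertonDyer.Theorems.AdditiveKoly

end
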